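import Mathlib
import HarnessLib

/-!
# Crux `EvenPatternDecoupling` (stmt-CriticalPhenomena-16133), line `registered`: the real-analysis ASSEMBLY of the birth skeleton

`decoupling_assembly` (birth skeleton, planner-skel, proved; landed here unchanged, binders closed at `Type`): for ANY point
functional `F` and ball functional `G` over a finite product of metric balls, (ball limits exist for admissible families) +
(locally uniform point-to-ball decoupling at fine scales) + (pointwise non-degeneracy) ⇒ a continuous positive `q` with `F → q`
locally uniformly along `𝓝[>] 0` and the identification of `q z` with the iterated limit of `G` along every inner family
shrinking to `z` — the shape of the crux `ArmDressing.EvenPatternDecoupling`. Mechanism: Cauchy along `𝓝[>] 0` from ONE fine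
admissible centred family per neighbourhood, completeness of `ℝ`, one local constant per neighbourhood, uniqueness of limits,
eventual admissibility of shrinking families (`admissible_of_fine`).
-/

namespace Summit.CriticalPhenomena.Ising3DConformalLimit.Theorems.EvenPatternDecoupling

open scoped Topology
open Filter Set Metric

/-- Metric lemma (proved): an inner family that is fine enough around a configuration `z` of the domain and
contains `z` well inside is ADMISSIBLE — its closed balls lie inside the open outer balls. (`2 s_j < gap_j`.) -/
theorem admissible_of_fine {ι X : Type*} [Finite ι] [PseudoMetricSpace X] (c : ι → X) (r : ι → ℝ)
    (z : ι → X) (hz : ∀ j, z j ∈ ball (c j) (r j)) :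
    ∃ η₁ : ℝ, 0 < η₁ ∧ ∀ (b : ι → X) (s : ι → ℝ), (∀ j, 0 < s j ∧ s j < η₁) →
      (∀ j, z j ∈ ball (b j) (s j / 2)) → ∀ j, closedBall (b j) (s j) ⊆ ball (c j) (r j) := by
  have hev : ∀ᶠ η in 𝓝[>] (0:ℝ), 0 < η ∧ ∀ j, 2 * η < r j - dist (z j) (c j) := by
    refine Filter.Eventually.and self_mem_nhdsWithin (eventually_all.2 fun j => ?_)
    have hgap : 0 < r j - dist (z j) (c j) := sub_pos.2 (mem_ball.1 (hz j))
    have hj : ∀ᶠ η in 𝓝 (0:ℝ), η < (r j - dist (z j) (c j)) / 2 := Iio_mem_nhds (half_pos hgap)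
    exact (hj.filter_mono nhdsWithin_le_nhds).mono fun η hη => by linarith
  obtain ⟨η₁, hη₁, hgap⟩ := hev.exists
  refine ⟨η₁, hη₁, fun b s hs hzb j x hx => ?_⟩
  rw [mem_closedBall] at hx
  have h1 := mem_ball.1 (hzb j)
  have h2 := hgap j
  have h3 := hs j
  rw [mem_ball]
  calc dist x (c j) ≤ dist x (b j) + dist (b j) (z j) + dist (z j) (c j) := dist_triangle4 _ _ _ _
    _ < r j := by rw [dist_comm (b j) (z j)]; linarith [h3.1, h3.2]

/-- ASSEMBLY, abstract form (proved, no sorry): for ANY point functional `F` and ball functional `G` over a finite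
product of metric balls, (ball limits exist for admissible families) + (locally uniform point-to-ball decoupling at
fine scales) + (pointwise non-degeneracy) ⇒ a continuous positive `q` with `F → q` locally uniformly along
`𝓝[>] 0` and the identification of `q z` with the iterated limit of `G` along every inner family shrinking to `z`.
Mechanism: Cauchy along `𝓝[>] 0` from ONE fine admissible centred family per neighbourhood (completeness of `ℝ`),
the same local constant controls `q` on the neighbourhood (continuity, local uniformity), uniqueness of limits for
the identification, eventual admissibility of shrinking families by `admissible_of_fine`. -/
-- the header below is the registered stub signature (whitespace-compressed; binders closed at `Type`)
theorem decoupling_assembly : open Filter Set Metric Topology in ∀ {ι X : Type} [Fintype ι] [PseudoMetricSpace X] (c : ι→X) (r : ι→ℝ) (F : ℝ→(ι→X)→ℝ) (G : ℝ→(ι→X)→(ι→ℝ)→ℝ) (h1 : ∀ (b : ι→X) (s : ι→ℝ), (∀ j, 0 < s j)→(∀ j, closedBall (b j) (s j) ⊆ ball (c j) (r j))→∃ M : ℝ, Tendsto (fun δ=>G δ b s) (𝓝[>] 0) (𝓝 M)) (h2 : ∀ z₀ : ι→X, (∀ j, z₀ j ∈ ball (c j) (r j))→∀ ε : ℝ,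 0 < ε→∃ V ∈ 𝓝 z₀, ∃ η₀ : ℝ, 0 < η₀ ∧ ∀ (b : ι→X) (s : ι→ℝ), (∀ j, 0 < s j ∧ s j < η₀)→(∀ j, closedBall (b j) (s j) ⊆ ball (c j) (r j))→∀ᶠ δ in 𝓝[>] 0, ∀ z ∈ V, (∀ j, z j ∈ ball (b j) (s j / 2))→|F δ z - G δ b s| ≤ ε) (h3 : ∀ z : ι→X, (∀ j, z j ∈ ball (c j) (r j))→∃ p : ℝ, 0 < p ∧ ∃ᶠ δ in 𝓝[>] 0, p ≤ F δ z), ∃ q : (ι→X)→ℝ, ContinuousOn q {z | ∀ j, z j ∈ ball (c j) (r j)} ∧ (∀ z : ι→X, (∀ j, z j ∈ ball (c j) (r j))→0 < q z) ∧ TendstoLocallyUniformlyOn F q (𝓝[>] 0) {z | ∀ j, z j ∈ ball (c j) (r j)} ∧ (∀ z : ι→X, (∀ j, z j ∈ ball (c j) (r j))→∀ (ci : ℝ→ι→X) (ri : ℝ→ι→ℝ), (∀ j, Tendsto (fun η=>ri η j) (𝓝[>] 0) (𝓝 0))→(∀ᶠ η in 𝓝[>] 0, ∀ j, 0 < ri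 η j ∧ z j ∈ ball (ci η j) (ri η j / 2))→∃ Λ : ℝ→ℝ, (∀ᶠ η in 𝓝[>] 0, Tendsto (fun δ=>G δ (ci η) (ri η)) (𝓝[>] 0) (𝓝 (Λ η))) ∧ Tendsto Λ (𝓝[>] 0) (𝓝 (q z))) := by
  intro ι X _ _ c r F G h1 h2 h3
  -- (1) local closeness: around every `z₀ ∈ U`, `F(δ, ·)` is eventually `ε`-close to ONE constant, uniformly
  have hC : ∀ z₀ : ι → X, (∀ j, z₀ j ∈ ball (c j) (r j)) → ∀ ε : ℝ, 0 < ε →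
      ∃ T ∈ 𝓝 z₀, (∀ z ∈ T, ∀ j, z j ∈ ball (c j) (r j)) ∧
        ∃ M : ℝ, ∀ᶠ δ in 𝓝[>] (0:ℝ), ∀ z ∈ T, |F δ z - M| ≤ ε := by
    intro z₀ hz₀ ε hε
    obtain ⟨V, hV, η₀, hη₀, hdec⟩ := h2 z₀ hz₀ (ε / 2) (half_pos hε)
    obtain ⟨η₁, hη₁, hadm⟩ := admissible_of_fine c r z₀ hz₀
    obtain ⟨s₀, hs₀, hs₀η₀, hs₀η₁⟩ : ∃ s₀ : ℝ, 0 < s₀ ∧ s₀ < η₀ ∧ s₀ < η₁ :=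
      ⟨min η₀ η₁ / 2, by positivity, by linarith [min_le_left η₀ η₁, lt_min hη₀ hη₁],
        by linarith [min_le_right η₀ η₁, lt_min hη₀ hη₁]⟩
    have hself : ∀ j, z₀ j ∈ ball (z₀ j) (s₀ / 2) := fun j => mem_ball_self (half_pos hs₀)
    have hadm' : ∀ j, closedBall (z₀ j) s₀ ⊆ ball (c j) (r j) :=
      hadm z₀ (fun _ => s₀) (fun _ => ⟨hs₀, hs₀η₁⟩) hself
    have hopen : IsOpen {z : ι → X | ∀ j, z j ∈ ball (z₀ j) (s₀ / 2)} := by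
      have hEq : {z : ι → X | ∀ j, z j ∈ ball (z₀ j) (s₀ / 2)} =
          ⋂ j, (fun z : ι → X => z j) ⁻¹' ball (z₀ j) (s₀ / 2) := by
        ext z; simp
      rw [hEq]
      exact isOpen_iInter_of_finite fun j => isOpen_ball.preimage (continuous_apply j)
    refine ⟨V ∩ {z | ∀ j, z j ∈ ball (z₀ j) (s₀ / 2)}, inter_mem hV (hopen.mem_nhds hself), ?_, ?_⟩
    · intro z hz j
      have hzj : z j ∈ ball (z₀ j) (s₀ / 2) := hz.2 j
      exact hadm' j (mem_closedBall.2 (by have := mem_ball.1 hzj; linarith))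
    obtain ⟨M, hM⟩ := h1 z₀ (fun _ => s₀) (fun _ => hs₀) hadm'
    refine ⟨M, ?_⟩
    have hF := hdec z₀ (fun _ => s₀) (fun _ => ⟨hs₀, hs₀η₀⟩) hadm'
    have hG : ∀ᶠ δ in 𝓝[>] (0:ℝ), |G δ z₀ (fun _ => s₀) - M| ≤ ε / 2 := by
      have hε2 : (0:ℝ) < ε / 2 := half_pos hε
      exact ((Metric.tendsto_nhds.1 hM) (ε / 2) hε2).mono fun δ h => by
        rw [Real.dist_eq] at h; exact h.le
    filter_upwards [hF, hG] with δ hFδ hGδ z hz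
    have hzin : ∀ j, z j ∈ ball (z₀ j) (s₀ / 2) := hz.2
    have h := hFδ z hz.1 hzin
    calc |F δ z - M| ≤ |F δ z - G δ z₀ (fun _ => s₀)| + |G δ z₀ (fun _ => s₀) - M| := abs_sub_le _ _ _
      _ ≤ ε / 2 + ε / 2 := add_le_add h hGδ
      _ = ε := by ring
  -- (2) pointwise limits exist: `F(·, z)` is Cauchy along `𝓝[>] 0`, and `ℝ` is complete
  have hlim : ∀ z : ι → X, (∀ j, z j ∈ ball (c j) (r j)) →
      ∃ L : ℝ, Tendsto (fun δ => F δ z) (𝓝[>] 0) (𝓝 L) := by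
    intro z hz
    apply cauchy_map_iff_exists_tendsto.1
    rw [Metric.cauchy_iff]
    refine ⟨Filter.map_neBot, fun ε hε => ?_⟩
    obtain ⟨T, hT, -, M, hM⟩ := hC z hz (ε / 4) (by positivity)
    have hmem : {x : ℝ | |x - M| ≤ ε / 4} ∈ map (fun δ => F δ z) (𝓝[>] (0:ℝ)) :=
      mem_map.2 (hM.mono fun δ hδ => hδ z (mem_of_mem_nhds hT))
    refine ⟨{x : ℝ | |x - M| ≤ ε / 4}, hmem, ?_⟩
    intro x hx y hy
    have hx' : |x - M| ≤ ε / 4 := hx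
    have hy' : |y - M| ≤ ε / 4 := hy
    rw [Real.dist_eq]
    calc |x - y| ≤ |x - M| + |M - y| := abs_sub_le _ _ _
      _ = |x - M| + |y - M| := by rw [abs_sub_comm M y]
      _ ≤ ε / 4 + ε / 4 := add_le_add hx' hy'
      _ < ε := by linarith
  choose! L hL using hlim
  -- (3) the local constant controls the limit: `|L z - M| ≤ ε` on `T`
  have hLM : ∀ (T : Set (ι → X)) (M ε : ℝ), (∀ z ∈ T, ∀ j, z j ∈ ball (c j) (r j)) →
      (∀ᶠ δ in 𝓝[>] (0:ℝ), ∀ z ∈ T, |F δ z - M| ≤ ε) → ∀ z ∈ T, |L z - M| ≤ ε := by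
    intro T M ε hTU hFM z hz
    have ht : Tendsto (fun δ => |F δ z - M|) (𝓝[>] 0) (𝓝 |L z - M|) :=
      ((hL z (hTU z hz)).sub_const M).abs
    exact le_of_tendsto ht (hFM.mono fun δ h => h z hz)
  refine ⟨L, ?_, ?_, ?_, ?_⟩
  · -- continuity on `U`
    intro z₀ hz₀
    have hz₀' : ∀ j, z₀ j ∈ ball (c j) (r j) := hz₀
    rw [ContinuousWithinAt, Metric.tendsto_nhds]
    intro ε hε
    obtain ⟨T, hT, hTU, M, hFM⟩ := hC z₀ hz₀' (ε / 4) (by positivity)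
    have hb := hLM T M (ε / 4) hTU hFM
    filter_upwards [mem_nhdsWithin_of_mem_nhds hT] with z hz
    rw [Real.dist_eq]
    calc |L z - L z₀| ≤ |L z - M| + |M - L z₀| := abs_sub_le _ _ _
      _ = |L z - M| + |L z₀ - M| := by rw [abs_sub_comm M]
      _ ≤ ε / 4 + ε / 4 := add_le_add (hb z hz) (hb z₀ (mem_of_mem_nhds hT))
      _ < ε := by linarith
  · -- positivity
    intro z hz
    obtain ⟨p, hp, hfr⟩ := h3 z hz
    refine lt_of_lt_of_le hp ?_
    by_contra hlt
    have hlt' : L z < p := not_le.1 hlt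
    have hev : ∀ᶠ δ in 𝓝[>] (0:ℝ), F δ z < p := (hL z hz).eventually (Iio_mem_nhds hlt')
    obtain ⟨δ, hδ1, hδ2⟩ := (hfr.and_eventually hev).exists
    exact absurd hδ2 (not_lt.2 hδ1)
  · -- locally uniform convergence on `U`
    rw [Metric.tendstoLocallyUniformlyOn_iff]
    intro ε hε z₀ hz₀
    have hz₀' : ∀ j, z₀ j ∈ ball (c j) (r j) := hz₀
    obtain ⟨T, hT, hTU, M, hFM⟩ := hC z₀ hz₀' (ε / 4) (by positivity)
    have hb := hLM T M (ε / 4) hTU hFM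
    refine ⟨T, mem_nhdsWithin_of_mem_nhds hT, ?_⟩
    filter_upwards [hFM] with δ hδ z hz
    rw [Real.dist_eq]
    calc |L z - F δ z| ≤ |L z - M| + |M - F δ z| := abs_sub_le _ _ _
      _ = |L z - M| + |F δ z - M| := by rw [abs_sub_comm M]
      _ ≤ ε / 4 + ε / 4 := add_le_add (hb z hz) (hδ z hz)
      _ < ε := by linarith
  · -- identification: point limit = iterated ball limit along every inner family shrinking to `z`
    intro z hz ci ri hri hin
    obtain ⟨η₁, hη₁, hadm⟩ := admissible_of_fine c r z hz
    have hsmall : ∀ η' : ℝ, 0 < η' → ∀ᶠ η in 𝓝[>] (0:ℝ), ∀ j, ri η j < η' := fun η' hη' =>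
      eventually_all.2 fun j => (hri j).eventually (Iio_mem_nhds hη')
    have hadmev : ∀ᶠ η in 𝓝[>] (0:ℝ), (∀ j, 0 < ri η j ∧ z j ∈ ball (ci η j) (ri η j / 2)) ∧
        ∀ j, closedBall (ci η j) (ri η j) ⊆ ball (c j) (r j) := by
      filter_upwards [hin, hsmall η₁ hη₁] with η h hs
      exact ⟨h, hadm (ci η) (ri η) (fun j => ⟨(h j).1, hs j⟩) fun j => (h j).2⟩
    refine ⟨fun η => limUnder (𝓝[>] (0:ℝ)) (fun δ => G δ (ci η) (ri η)), ?_, ?_⟩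
    · filter_upwards [hadmev] with η h
      exact tendsto_nhds_limUnder (h1 (ci η) (ri η) (fun j => (h.1 j).1) h.2)
    · rw [Metric.tendsto_nhds]
      intro ε hε
      obtain ⟨V, hV, η₀, hη₀, hdec⟩ := h2 z hz (ε / 2) (half_pos hε)
      filter_upwards [hadmev, hsmall η₀ hη₀] with η h hs
      have hΛ : Tendsto (fun δ => G δ (ci η) (ri η)) (𝓝[>] 0)
          (𝓝 (limUnder (𝓝[>] (0:ℝ)) (fun δ => G δ (ci η) (ri η)))) :=
        tendsto_nhds_limUnder (h1 (ci η) (ri η) (fun j => (h.1 j).1) h.2)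
      have hev : ∀ᶠ δ in 𝓝[>] (0:ℝ), |F δ z - G δ (ci η) (ri η)| ≤ ε / 2 :=
        (hdec (ci η) (ri η) (fun j => ⟨(h.1 j).1, hs j⟩) h.2).mono fun δ hδ =>
          hδ z (mem_of_mem_nhds hV) fun j => (h.1 j).2
      have hle : |L z - limUnder (𝓝[>] (0:ℝ)) (fun δ => G δ (ci η) (ri η))| ≤ ε / 2 :=
        le_of_tendsto (((hL z hz).sub hΛ).abs) hev
      rw [Real.dist_eq, abs_sub_comm]
      linarith

end Summit.CriticalPhenomena.Ising3DConformalLimit.Theorems.EvenPatternDecoupling
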